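import Literature.Analysis.FluidPDE.SuitableWeakStability
import Literature.Analysis.FluidPDE.LocalTypeILscGradientTools
import Literature.Analysis.FunctionSpaces.WeakCompactnessL1Proofs
import Literature.Analysis.FunctionSpaces.AubinLionsSlices
import HarnessLib

/-!
# Weak `L²` limits of weak spatial gradients along `L²`-convergent velocities

Analysis/FluidPDE theorem file (no new definitions, no named facts). The gradient half of the
"weak convergence in `L²(0,T;H¹)`" step of every compactness argument for weak solutions of the
Navier–Stokes equations (Temam 1977/79, Ch. III, §3; Lemarié-Rieusset 2016, Thm. 12.2;
Bradshaw–Tsai 2019, §4.3: "`vₖ` converges to `v` … in the weak topology on `L²(0,T;H¹(B₁))`";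
Lin 1998, Thm. 2.2):

* `exists_subseq_weakGradient_weakLimit` — let `vₖ → u` in `L²(Q)` on an open space–time region
  `Q` of finite measure, and let `Gₖ` be weak spatial gradients of `vₖ` on `Q` with
  `∫_Q |Gₖ|²_F ≤ C_g`. Then along a subsequence the columns `Gₖ a` converge weakly in `L²(Q; E)`
  (for every direction `a`, against every `h ∈ L²(Q; E)`) to the columns of an operator field `G`
  which is a weak spatial gradient of `u` on `Q` with `∫_Q |G|²_F ≤ C_g` (weak sequential
  compactness of bounded sequences in the Hilbert spaces `L²(Q; E)` — the tree's
  `exists_strictMono_forall_tendsto_inner` — applied to the columns `Gₖ bᵢ` in an orthonormal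
  frame; the defining identity `∫∫ ∂ₐφ ⟪vₖ, w⟫ = -∫∫ φ ⟪Gₖ a, w⟫` passes to the limit, strongly
  on the left and weakly on the right; the bound is the weak lower semicontinuity of the norm in
  `⊕ᵢ L²`, `sum_lintegral_enorm_sq_le_of_tendsto_integral_inner`).

## References

* R. Temam, *Navier–Stokes equations* (North-Holland 1977/79), Ch. III, §3 (3.40)–(3.43).
  [Temam1979]
* Z. Bradshaw, T.-P. Tsai, Analysis & PDE 12 (2019) = arXiv:1801.08060, §4.3. [BradshawTsai2019]
* H. Brezis, *Functional Analysis, Sobolev Spaces and PDE* (2011), Thm. 3.18, Prop. 3.5 (iii).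
  [Brezis2011]
-/

noncomputable section

open MeasureTheory TopologicalSpace Set Function Filter Metric
open scoped ENNReal NNReal Topology InnerProductSpace RealInnerProductSpace

namespace Literature.Analysis.FluidPDE

variable {E : Type*} [NormedAddCommGroup E] [InnerProductSpace ℝ E] [FiniteDimensional ℝ E]

/-- `ofReal |L|²_F = ∑ᵢ ‖L bᵢ‖ₑ²` in the standard orthonormal frame. [folklore] -/
theorem ofReal_frobeniusNormSq_eq_sum_enorm_sq' (L : E →L[ℝ] E) :
    ENNReal.ofReal (frobeniusNormSq L) = ∑ i, ‖L (stdOrthonormalBasis ℝ E i)‖ₑ ^ 2 := by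
  rw [frobeniusNormSq, ENNReal.ofReal_sum_of_nonneg fun i _ => sq_nonneg _]
  refine Finset.sum_congr rfl fun i _ => ?_
  rw [← ofReal_norm, ENNReal.ofReal_pow (norm_nonneg _)]

/-- The operator with prescribed columns `gᵢ` in the standard orthonormal frame `b`:
`(∑ᵢ ⟪bᵢ, ·⟫ gᵢ) bⱼ = gⱼ`. [folklore] -/
theorem sum_smulRight_apply_basis (g : Fin (Module.finrank ℝ E) → E) (j : Fin (Module.finrank ℝ E)) :
    (∑ i, (innerSL ℝ (stdOrthonormalBasis ℝ E i)).smulRight (g i)) (stdOrthonormalBasis ℝ E j) =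
      g j := by
  set b := stdOrthonormalBasis ℝ E
  rw [FunLike.coe_sum, Finset.sum_apply]
  simp only [ContinuousLinearMap.smulRight_apply, innerSL_apply_apply]
  have h : ∀ i, ⟪b i, b j⟫ • g i = if i = j then g i else 0 := fun i => by
    rw [orthonormal_iff_ite.1 b.orthonormal i j]
    split_ifs <;> simp
  simp_rw [h]
  rw [Finset.sum_ite_eq' Finset.univ j]
  simp

/-- The operator with prescribed columns, applied to a general vector: `(∑ᵢ ⟪bᵢ, ·⟫ gᵢ) a =
∑ᵢ ⟪bᵢ, a⟫ gᵢ`. [folklore] -/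
theorem sum_smulRight_apply (g : Fin (Module.finrank ℝ E) → E) (a : E) :
    (∑ i, (innerSL ℝ (stdOrthonormalBasis ℝ E i)).smulRight (g i)) a =
      ∑ i, ⟪stdOrthonormalBasis ℝ E i, a⟫ • g i := by
  rw [FunLike.coe_sum, Finset.sum_apply]
  simp only [ContinuousLinearMap.smulRight_apply, innerSL_apply_apply]

/-- Expansion of `L a` along the standard orthonormal frame: `L a = ∑ᵢ ⟪bᵢ, a⟫ L bᵢ`. [folklore] -/
theorem clm_apply_eq_sum_inner_smul (L : E →L[ℝ] E) (a : E) :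
    L a = ∑ i, ⟪stdOrthonormalBasis ℝ E i, a⟫ • L (stdOrthonormalBasis ℝ E i) := by
  conv_lhs => rw [← (stdOrthonormalBasis ℝ E).sum_repr' a]
  simp [map_sum, map_smul]

variable [MeasurableSpace E] [BorelSpace E]

/-- **Weak `L²` limits of weak spatial gradients.** Let `Q` be an open space–time region of
finite measure, `vₖ, u ∈ L²(Q)` with `‖vₖ - u‖_{L²(Q)} → 0`, and `Gₖ` weak spatial gradients of
`vₖ` on `Q` with `∫_Q |Gₖ|²_F ≤ C_g < ∞`. Then there are a subsequence `σ` and an operator field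
`G` on `Q` such that: `G` is a weak spatial gradient of `u` on `Q`; `∫_Q |G|²_F ≤ C_g`; and for
every direction `a` and every `h ∈ L²(Q; E)`, `∫_Q ⟪G_{σ k} a, h⟫ → ∫_Q ⟪G a, h⟫`
("`vₖ → v` weakly in `L²(0,T;H¹)`": Bradshaw–Tsai 2019, §4.3; Temam 1977/79, Ch. III, §3;
Brezis 2011, Thm. 3.18 and Prop. 3.5 (iii) for the extraction and the bound). [cite: BradshawTsai2019, §4.3 (proof of Thm 1.2), "in the weak topology on L²(0,T;H¹(B₁))"] [cite: Brezis2011, Thm. 3.18 with Prop. 3.5 (iii)] -/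
theorem exists_subseq_weakGradient_weakLimit {Q : Opens (ℝ × E)}
    (hQ : volume (Q : Set (ℝ × E)) ≠ ∞) {v : ℕ → ℝ → E → E} {u : ℝ → E → E}
    {G : ℕ → ℝ → E → E →L[ℝ] E} {Cg : ℝ≥0∞} (hCg : Cg ≠ ∞)
    (hG : ∀ k, HasWeakSpatialGradientOn Q (v k) (G k))
    (hGb : ∀ k, ∫⁻ z in (Q : Set (ℝ × E)), ENNReal.ofReal (frobeniusNormSq (G k z.1 z.2)) ≤ Cg)
    (hv2 : ∀ k, MemLp (uncurry (v k)) 2 (volume.restrict (Q : Set (ℝ × E))))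
    (hu2 : MemLp (uncurry u) 2 (volume.restrict (Q : Set (ℝ × E))))
    (hconv : Tendsto (fun k => eLpNorm (uncurry (v k) - uncurry u) 2
      (volume.restrict (Q : Set (ℝ × E)))) atTop (𝓝 0)) :
    ∃ (σ : ℕ → ℕ) (Gu : ℝ → E → E →L[ℝ] E), StrictMono σ ∧
      HasWeakSpatialGradientOn Q u Gu ∧
      ∫⁻ z in (Q : Set (ℝ × E)), ENNReal.ofReal (frobeniusNormSq (Gu z.1 z.2)) ≤ Cg ∧
      ∀ (a : E) (h : ℝ × E → E), MemLp h 2 (volume.restrict (Q : Set (ℝ × E))) →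
        Tendsto (fun k => ∫ z in (Q : Set (ℝ × E)), ⟪G (σ k) z.1 z.2 a, h z⟫) atTop
          (𝓝 (∫ z in (Q : Set (ℝ × E)), ⟪Gu z.1 z.2 a, h z⟫)) := by
  haveI : Fact ((1 : ℝ≥0∞) ≤ 2) := ⟨one_le_two⟩
  set S : Set (ℝ × E) := (Q : Set (ℝ × E)) with hS
  have hSm : MeasurableSet S := Q.isOpen.measurableSet
  set μQ : Measure (ℝ × E) := volume.restrict S with hμQ
  haveI : IsFiniteMeasure μQ := ⟨by rw [hμQ, Measure.restrict_apply_univ]; exact hQ.lt_top⟩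
  set ι := Fin (Module.finrank ℝ E)
  set b := stdOrthonormalBasis ℝ E with hb
  -- the columns `Gₖ bᵢ` as a bounded family in `L²(Q; E)`
  have hGm : ∀ k, AEStronglyMeasurable (uncurry (G k)) μQ := fun k =>
    (hG k).locallyIntegrableOn_grad.aestronglyMeasurable
  have hcolm : ∀ {H : ℝ × E → E →L[ℝ] E}, AEStronglyMeasurable H μQ → ∀ a : E,
      AEStronglyMeasurable (fun z => H z a) μQ := fun {H} hH a =>
    (ContinuousLinearMap.apply ℝ E a).continuous.comp_aestronglyMeasurable hH
  set col : ℕ → ι → ℝ × E → E := fun k i z => G k z.1 z.2 (b i) with hcol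
  have hcolm' : ∀ k i, AEStronglyMeasurable (col k i) μQ := fun k i => hcolm (hGm k) (b i)
  have hsum_col : ∀ k, ∑ i, ∫⁻ z, ‖col k i z‖ₑ ^ 2 ∂μQ =
      ∫⁻ z, ENNReal.ofReal (frobeniusNormSq (G k z.1 z.2)) ∂μQ := fun k => by
    rw [← lintegral_finsetSum' _ fun i _ => (hcolm' k i).enorm.pow_const 2]
    exact lintegral_congr fun z => (ofReal_frobeniusNormSq_eq_sum_enorm_sq' _).symm
  have hcol2 : ∀ k i, ∫⁻ z, ‖col k i z‖ₑ ^ 2 ∂μQ ≤ Cg := fun k i =>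
    ((Finset.single_le_sum (f := fun j => ∫⁻ z, ‖col k j z‖ₑ ^ 2 ∂μQ) (fun _ _ => zero_le)
      (Finset.mem_univ i)).trans ((hsum_col k).le.trans (hGb k)))
  have hcolL : ∀ k i, MemLp (col k i) 2 μQ := fun k i => by
    refine ⟨hcolm' k i, ?_⟩
    rw [FunctionSpaces.AubinLions.eLpNorm_two_eq_rpow]
    exact ENNReal.rpow_lt_top_of_nonneg (by norm_num) ((hcol2 k i).trans_lt hCg.lt_top).ne
  set M : ℝ := (Cg ^ (1 / 2 : ℝ)).toReal with hM
  set V : ι → ℕ → Lp E 2 μQ := fun i k => (hcolL k i).toLp (col k i) with hV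
  have hVM : ∀ i k, ‖V i k‖ ≤ M := fun i k => by
    rw [hV, Lp.norm_toLp, hM]
    refine ENNReal.toReal_mono (ENNReal.rpow_ne_top_of_nonneg (by norm_num) hCg) ?_
    rw [FunctionSpaces.AubinLions.eLpNorm_two_eq_rpow]
    exact ENNReal.rpow_le_rpow (hcol2 k i) (by norm_num)
  -- extraction
  obtain ⟨σ, hσ, hw⟩ := FunctionSpaces.exists_strictMono_forall_tendsto_inner
    (H := fun _ : ι => Lp E 2 μQ) V (fun _ => M) hVM
  choose w _ hwlim using hw
  -- the limit columns and the limit operator field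
  set g : ι → ℝ × E → E := fun i => (w i : ℝ × E → E) with hg
  have hgL : ∀ i, MemLp (g i) 2 μQ := fun i => Lp.memLp (w i)
  have hgto : ∀ i, (hgL i).toLp (g i) = w i := fun i => Lp.toLp_coeFn (w i) (Lp.memLp (w i))
  obtain ⟨Gu, hGu_def⟩ : ∃ Gu : ℝ → E → E →L[ℝ] E,
      Gu = fun t x => ∑ i, (innerSL ℝ (b i)).smulRight (g i (t, x)) := ⟨_, rfl⟩
  have hGu_eq : uncurry Gu = fun z => ∑ i, (innerSL ℝ (b i)).smulRight (g i z) := by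
    rw [hGu_def]; rfl
  have hGucol : ∀ (z : ℝ × E) (j : ι), Gu z.1 z.2 (b j) = g j z := fun z j => by
    rw [hGu_def]; exact sum_smulRight_apply_basis (fun i => g i z) j
  -- pairings in `L²(Q; E)` are integrals
  have hpair : ∀ {f h : ℝ × E → E} (hf : MemLp f 2 μQ) (hh : MemLp h 2 μQ),
      ⟪hf.toLp f, hh.toLp h⟫ = ∫ z, ⟪f z, h z⟫ ∂μQ := fun {f h} hf hh => by
    rw [L2.inner_def]
    refine integral_congr_ae ?_
    filter_upwards [hf.coeFn_toLp, hh.coeFn_toLp] with z hz hz'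
    rw [hz, hz']
  -- weak convergence of the columns
  have hwcol : ∀ (i : ι) (h : ℝ × E → E), MemLp h 2 μQ →
      Tendsto (fun k => ∫ z, ⟪col (σ k) i z, h z⟫ ∂μQ) atTop (𝓝 (∫ z, ⟪g i z, h z⟫ ∂μQ)) := by
    intro i h hh
    have h1 := hwlim i (hh.toLp h)
    have e1 : ∀ k, ⟪V i (σ k), hh.toLp h⟫ = ∫ z, ⟪col (σ k) i z, h z⟫ ∂μQ := fun k =>
      hpair (hcolL (σ k) i) hh
    have e2 : ⟪w i, hh.toLp h⟫ = ∫ z, ⟪g i z, h z⟫ ∂μQ := by rw [← hgto i]; exact hpair (hgL i) hh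
    simp only [e1, e2] at h1
    exact h1
  -- weak convergence for a general direction
  have hint_col : ∀ {f h : ℝ × E → E}, MemLp f 2 μQ → MemLp h 2 μQ →
      Integrable (fun z => ⟪f z, h z⟫) μQ := fun {f h} hf hh =>
    (hf.norm.integrable_mul hh.norm).mono' (hf.1.inner hh.1)
      (Eventually.of_forall fun z => by
        rw [Pi.mul_apply]
        exact norm_inner_le_norm (f z) (h z))
  have hexp : ∀ {H : ℝ × E → E →L[ℝ] E} (hHc : ∀ i, MemLp (fun z => H z (b i)) 2 μQ) (a : E)
      {h : ℝ × E → E} (hh : MemLp h 2 μQ),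
      ∫ z, ⟪H z a, h z⟫ ∂μQ = ∑ i, ⟪b i, a⟫ * ∫ z, ⟪H z (b i), h z⟫ ∂μQ := by
    intro H hHc a h hh
    have e : ∀ z, ⟪H z a, h z⟫ = ∑ i, ⟪b i, a⟫ * ⟪H z (b i), h z⟫ := fun z => by
      rw [clm_apply_eq_sum_inner_smul (H z) a, sum_inner]
      simp only [real_inner_smul_left, hb]
    simp_rw [e]
    rw [integral_finsetSum _ fun i _ => (hint_col (hHc i) hh).const_mul _]
    simp_rw [integral_const_mul]
  have hGucolL : ∀ i, MemLp (fun z : ℝ × E => Gu z.1 z.2 (b i)) 2 μQ := fun i => by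
    simp_rw [hGucol]; exact hgL i
  have hGw : ∀ (a : E) (h : ℝ × E → E), MemLp h 2 μQ →
      Tendsto (fun k => ∫ z, ⟪G (σ k) z.1 z.2 a, h z⟫ ∂μQ) atTop
        (𝓝 (∫ z, ⟪Gu z.1 z.2 a, h z⟫ ∂μQ)) := by
    intro a h hh
    have e1 : ∀ k, ∫ z, ⟪G (σ k) z.1 z.2 a, h z⟫ ∂μQ =
        ∑ i, ⟪b i, a⟫ * ∫ z, ⟪col (σ k) i z, h z⟫ ∂μQ := fun k =>
      hexp (H := fun z => G (σ k) z.1 z.2) (fun i => hcolL (σ k) i) a hh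
    have e2 : ∫ z, ⟪Gu z.1 z.2 a, h z⟫ ∂μQ = ∑ i, ⟪b i, a⟫ * ∫ z, ⟪g i z, h z⟫ ∂μQ := by
      rw [hexp (H := fun z => Gu z.1 z.2) hGucolL a hh]
      simp_rw [hGucol]
    rw [e2]
    simp_rw [e1]
    exact tendsto_finsetSum _ fun i _ => (hwcol i h hh).const_mul _
  -- measurability and integrability of `Gu` on `Q`
  have hsmulc : ∀ i, Continuous fun y : E => (innerSL ℝ (b i)).smulRight y := fun i =>
    (ContinuousLinearMap.smulRightL ℝ E E (innerSL ℝ (b i))).continuous.congr fun y => by simp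
  have hGuI : Integrable (uncurry Gu) μQ := by
    rw [hGu_eq]
    have hm : AEStronglyMeasurable (fun z => ∑ i, (innerSL ℝ (b i)).smulRight (g i z)) μQ :=
      Finset.aestronglyMeasurable_fun_sum _ fun i _ => (hsmulc i).comp_aestronglyMeasurable (hgL i).1
    have hdom : Integrable (fun z => ∑ i, ‖g i z‖) μQ :=
      integrable_finsetSum _ fun i _ => ((hgL i).integrable one_le_two).norm
    refine hdom.mono' hm (Eventually.of_forall fun z => ?_)
    refine (norm_sum_le _ _).trans (le_of_eq (Finset.sum_congr rfl fun i _ => ?_))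
    rw [ContinuousLinearMap.norm_smulRight_apply, innerSL_apply_norm, b.orthonormal.1 i, one_mul]
  -- the Frobenius bound of the limit
  have hfrobGu : ∀ z : ℝ × E, ENNReal.ofReal (frobeniusNormSq (Gu z.1 z.2)) = ∑ i, ‖g i z‖ₑ ^ 2 :=
    fun z => by
      rw [ofReal_frobeniusNormSq_eq_sum_enorm_sq']
      exact Finset.sum_congr rfl fun i _ => by rw [hGucol]
  have hGub : ∫⁻ z, ENNReal.ofReal (frobeniusNormSq (Gu z.1 z.2)) ∂μQ ≤ Cg := by
    have hlim : Tendsto (fun k => ∑ i, ∫ z, ⟪col (σ k) i z, g i z⟫ ∂μQ) atTop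
        (𝓝 (∑ i, ∫ z, ⟪g i z, g i z⟫ ∂μQ)) :=
      tendsto_finsetSum _ fun i _ => hwcol i (g i) (hgL i)
    have key := FunctionSpaces.sum_lintegral_enorm_sq_le_of_tendsto_integral_inner (μ := μQ)
      (f := fun k i => col (σ k) i) (g := g) (B := Cg) (fun k i => hcolm' (σ k) i) hgL hlim
      (fun k => by rw [hsum_col]; exact hGb (σ k))
    calc ∫⁻ z, ENNReal.ofReal (frobeniusNormSq (Gu z.1 z.2)) ∂μQ = ∫⁻ z, ∑ i, ‖g i z‖ₑ ^ 2 ∂μQ :=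
          lintegral_congr hfrobGu
      _ = ∑ i, ∫⁻ z, ‖g i z‖ₑ ^ 2 ∂μQ := lintegral_finsetSum' _ fun i _ => (hgL i).1.enorm.pow_const 2
      _ ≤ Cg := key
  -- the weak-gradient identity passes to the limit
  have hGuW : HasWeakSpatialGradientOn Q u Gu := by
    refine ⟨IntegrableOn.locallyIntegrableOn (hu2.integrable one_le_two),
      IntegrableOn.locallyIntegrableOn hGuI, fun φ hφ a c => ?_⟩
    have hK : IsCompact (tsupport (uncurry φ)) := hφ.hasCompactSupport
    obtain ⟨Cφ, hCφ0, hφC, -, -, -⟩ := hφ.exists_scalar_weights_bound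
    -- the two weights
    set W : ℝ × E → E := fun z => (fderiv ℝ (φ z.1) z.2 a) • c with hW
    set Hc : ℝ × E → E := fun z => φ z.1 z.2 • c with hHc
    have hfd0 : ∀ z : ℝ × E, z ∉ tsupport (uncurry φ) → fderiv ℝ (φ z.1) z.2 = 0 := fun z hz => by
      have h0 : uncurry φ =ᶠ[𝓝 (z.1, z.2)] 0 := notMem_tsupport_iff_eventuallyEq.1 hz
      have hc2 : Continuous fun y : E => (z.1, y) := continuous_const.prodMk continuous_id
      have h2 : φ z.1 =ᶠ[𝓝 z.2] fun _ => (0 : ℝ) := (hc2.tendsto z.2).eventually h0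
      rw [h2.fderiv_eq, fderiv_fun_const, Pi.zero_apply]
    have hWc : Continuous W :=
      (hφ.continuous_fderiv_slice.clm_apply continuous_const).smul continuous_const
    obtain ⟨C, hC0, hC⟩ := exists_nonneg_bound_of_eq_zero_off_compact hK hWc fun z hz => by
      simp only [hW, hfd0 z hz, zero_apply, zero_smul]
    have hWm : AEStronglyMeasurable W μQ := hWc.aestronglyMeasurable
    have hHcm : AEStronglyMeasurable Hc μQ :=
      (hφ.contDiff.continuous.smul continuous_const).aestronglyMeasurable
    have hHcb : ∀ z, ‖Hc z‖ ≤ Cφ * ‖c‖ := fun z => by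
      rw [hHc, norm_smul]; exact mul_le_mul_of_nonneg_right (hφC z) (norm_nonneg _)
    have hHcL : MemLp Hc 2 μQ :=
      (memLp_top_of_bound hHcm (Cφ * ‖c‖) (Eventually.of_forall hHcb)).mono_exponent le_top
    -- strong side
    have hL : Tendsto (fun k => ∫ z, ⟪uncurry (v k) z, W z⟫ ∂μQ) atTop
        (𝓝 (∫ z, ⟪uncurry u z, W z⟫ ∂μQ)) :=
      tendsto_integral_inner_of_tendsto_eLpNorm_two_bdd hv2 hu2 hconv hWm hC0 hC
    -- weak side, and the identity for each `k`
    have hRt := hGw a Hc hHcL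
    have hid : ∀ k, ∫ z, ⟪G k z.1 z.2 a, Hc z⟫ ∂μQ = -∫ z, ⟪uncurry (v k) z, W z⟫ ∂μQ := by
      intro k
      have h1 := setIntegral_mul_inner_weakGradient_eq (hG k) hφ a c
      have h2 : ∫ z : ℝ × E, fderiv ℝ (φ z.1) z.2 a * ⟪v k z.1 z.2, c⟫ =
          ∫ z in S, fderiv ℝ (φ z.1) z.2 a * ⟪v k z.1 z.2, c⟫ :=
        (setIntegral_eq_integral_of_forall_compl_eq_zero fun z hz => by
          rw [hφ.fderiv_slice_eq_zero hz, zero_apply, zero_mul]).symm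
      calc ∫ z, ⟪G k z.1 z.2 a, Hc z⟫ ∂μQ
          = ∫ z in S, φ z.1 z.2 * ⟪G k z.1 z.2 a, c⟫ :=
            integral_congr_ae (Eventually.of_forall fun z => by
              simp only [hHc, real_inner_smul_right])
        _ = -∫ z in S, fderiv ℝ (φ z.1) z.2 a * ⟪v k z.1 z.2, c⟫ := by rw [h1, h2]
        _ = -∫ z, ⟪uncurry (v k) z, W z⟫ ∂μQ := by
            congr 1
            exact integral_congr_ae (Eventually.of_forall fun z => by
              simp only [hW, real_inner_smul_right, uncurry])
    have hRt' : Tendsto (fun k => ∫ z, ⟪G (σ k) z.1 z.2 a, Hc z⟫ ∂μQ) atTop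
        (𝓝 (-∫ z, ⟪uncurry u z, W z⟫ ∂μQ)) := by
      simp only [hid]
      exact (hL.comp hσ.tendsto_atTop).neg
    have heq : ∫ z, ⟪Gu z.1 z.2 a, Hc z⟫ ∂μQ = -∫ z, ⟪uncurry u z, W z⟫ ∂μQ :=
      tendsto_nhds_unique hRt hRt'
    -- the iterated integrals
    have hu1 : Integrable (uncurry u) μQ := hu2.integrable one_le_two
    have hIL : IntegrableOn (fun z : ℝ × E => fderiv ℝ (φ z.1) z.2 a * ⟪u z.1 z.2, c⟫) S volume := by
      have hm : AEStronglyMeasurable (fun z : ℝ × E => fderiv ℝ (φ z.1) z.2 a * ⟪u z.1 z.2, c⟫) μQ :=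
        (hφ.continuous_fderiv_slice.clm_apply continuous_const).aestronglyMeasurable.mul
          (hu2.1.inner aestronglyMeasurable_const)
      refine (hu1.norm.mul_const C).mono' hm (Eventually.of_forall fun z => ?_)
      have e : fderiv ℝ (φ z.1) z.2 a * ⟪u z.1 z.2, c⟫ = ⟪uncurry u z, W z⟫ := by
        simp only [hW, real_inner_smul_right, uncurry]
      rw [e]
      exact (norm_inner_le_norm _ _).trans (mul_le_mul_of_nonneg_left (hC z) (norm_nonneg _))
    have hIR : IntegrableOn (fun z : ℝ × E => φ z.1 z.2 * ⟪Gu z.1 z.2 a, c⟫) S volume := by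
      have hGa : Integrable (fun z : ℝ × E => Gu z.1 z.2 a) μQ :=
        (ContinuousLinearMap.apply ℝ E a).integrable_comp hGuI
      have hm : AEStronglyMeasurable (fun z : ℝ × E => φ z.1 z.2 * ⟪Gu z.1 z.2 a, c⟫) μQ :=
        hφ.contDiff.continuous.aestronglyMeasurable.mul (hGa.1.inner aestronglyMeasurable_const)
      refine ((hGa.norm.mul_const ‖c‖).const_mul Cφ).mono' hm (Eventually.of_forall fun z => ?_)
      rw [norm_mul]
      exact mul_le_mul (hφC z) (norm_inner_le_norm _ _) (norm_nonneg _) hCφ0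
    have eL : ∫ t, ∫ x, fderiv ℝ (φ t) x a * ⟪u t x, c⟫ = ∫ z, ⟪uncurry u z, W z⟫ ∂μQ := by
      rw [integral_integral_eq_setIntegral hIL fun z hz => by
        rw [hφ.fderiv_slice_eq_zero hz, zero_apply, zero_mul]]
      exact integral_congr_ae (Eventually.of_forall fun z => by
        simp only [hW, real_inner_smul_right, uncurry])
    have eR : ∫ t, ∫ x, φ t x * ⟪Gu t x a, c⟫ = ∫ z, ⟪Gu z.1 z.2 a, Hc z⟫ ∂μQ := by
      rw [integral_integral_eq_setIntegral hIR fun z hz => by rw [hφ.apply_eq_zero hz, zero_mul]]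
      exact integral_congr_ae (Eventually.of_forall fun z => by
        simp only [hHc, real_inner_smul_right])
    rw [eL, eR, heq, neg_neg]
  exact ⟨σ, Gu, hσ, hGuW, hGub, hGw⟩

end Literature.Analysis.FluidPDE

end
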